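import Summits.QuantumFields.YangMills.Theorems.FluctuationComparisonRegPrIntLS2BetaEmlMemberTransportMean
import Literature.MathematicalPhysics.QuantumLattice.BalabanBlockAverage
import HarnessLib

/-!
# S2β · `hFlat` road, brick (iii-a′) of UV3-NODE §57.8 (C) — THE MEMBER-MEAN LEMMA IN CONTEXT: replacing the printed average `E(W) = exp(mean log W_i)`
# by its members INSIDE `log(A · E(W) · B)` costs (small) × (the mean member size), for ANY near-identity invertible∕unitary context `A, B`
# (the hybrid step of the nonabelian KEY LEMMA: one averaged edge at a time, the other factors of the plaquette word held fixed)

Cell `ym3-torus` (rung R3 = continuum `SU(2)` Yang–Mills on the three-torus — NOT d = 4, NOT infinite volume, NOT a mass gap, NOT Clay).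
Width seat «width 8» `ym3-torus-px8` (gen 21), FREE px helper on crux `stmt-QuantumFields-20520`, count-neutral, DEFINITION-FREE.

MECHANISM.  `A·e^{a}·B = e^{A a A⁻¹}·(A·B)` (`exp` commutes with conjugation, lit ✓`exp_conj_eq_of_mul_eq_one`), the conjugated members `A a_i A⁻¹` have the same
mean structure (conjugation is linear) and, for unitary `A` in the operator norm, the SAME sizes (`‖A a A⁻¹‖ = ‖a‖`); so ✓`…EmlMemberTransportMean.norm_mlog_expMean_mul_sub_mean_le`
(context-free, `Y := log(AB)`) applies verbatim.  The context size enters only through `σ ≥ ‖log(AB)‖`.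

* §1 (any complete normed `ℂ`-algebra, invertible context `A` with inverse `A′`, any `B`): ★ `norm_mlog_conj_expMean_mul_sub_mean_le` — with `Y` such that `exp Y = A·B`,
  `‖Y‖ ≤ σ`, and conjugated sizes `‖A a_i A′‖ ≤ θ`: `‖log(A·exp(Σ w•a)·B) − Σ_i w_i•log(A·exp(a_i)·B)‖ ≤ 2K·Σ_i w_i‖A a_i A′‖`, `K = 12000(θ+σ)³ + ⅓σ(θ+σ)`.
* §2 (`SU(N)`, operator norm, `‖A X A⁻¹‖ = ‖X‖`): ★★ `norm_mlog_ctx_ESU_mul_sub_mean_le` — `W : ι → SU(N)` with `dist1 (W i) ≤ ρ < δ_N`,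
  `ρ ≤ 1∕20`, context `A, B ∈ SU(N)` with `dist1 (A·B) ≤ ρ′ ≤ 1∕20`:
  `‖log((A·ESU W·B : M_N)) − |I|⁻¹Σ_i log((A·W_i·B : M_N))‖ ≤ 2·(12000(θ+σ)³ + ⅓σ(θ+σ))·|I|⁻¹Σ_i‖log(W_i)‖`, `θ = ρ∕(1−ρ)`, `σ = ρ′∕(1−ρ′)`.

HONEST SCOPE.  Banach-algebra bookkeeping over ✓p814025 and lit letters; nothing of Bałaban's analysis; the coupling∕covariance step ((C)(2)'s mixed-difference letter),
the nonabelian KEY LEMMA, the recursion, `hFlat`, TUBE-REG∘, GAP♯∘, S2β, crux 20520 and `YM3TorusSU2` are NOT proved; no registered stub is closed; the Yang–Mills mass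
gap is NOT proved.
References: T. Bałaban, CMP **109** (1987) 249–301 [Balaban1987RG1] ((0.4)–(0.8) p.253); W. Rossmann, *Lie Groups* (OUP 2002) §1.3 [Rossmann2002].
-/

set_option autoImplicit false

noncomputable section

open NormedSpace
open scoped BigOperators Matrix.Norms.L2Operator

namespace Summit.QuantumFields.YangMills.Theorems.FluctuationComparisonRegPrIntLS2BetaEmlMemberTransportMeanContext

open Literature.MathematicalPhysics.QuantumLattice (exp_conj_eq_of_mul_eq_one)
open Literature.MathematicalPhysics.QuantumFieldTheory.Balaban1983to89
open Literature.MathematicalPhysics.QuantumFieldTheory.Balaban1983to89.MatrixLog (mlog exp_mlog norm_mlog_le_div)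
open Literature.MathematicalPhysics.QuantumFieldTheory.Balaban1983to89.ExpMeanLog (eml eml_eq_exp ESU coe_ESU_of_small deltaSU)
open Summit.QuantumFields.YangMills.Theorems.FluctuationComparisonRegPrIntLS2BetaEmlMemberTransportMean (norm_mlog_expMean_mul_sub_mean_le)

/-! ## §1 Invertible context in a Banach algebra -/

section Banach

variable {𝔸 : Type*} [NormedRing 𝔸] [NormedAlgebra ℂ 𝔸] [CompleteSpace 𝔸]

/-- ★ **MEMBER-MEAN IN CONTEXT** (`A A′ = A′ A = 1`, `exp Y = A·B`): convex weights `w_i ≥ 0`, `Σ w = 1`, conjugated member sizes `‖A a_i A′‖ ≤ θ`, `‖Y‖ ≤ σ`,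
`θ + σ ≤ 3∕20`:  `‖log(A·exp(Σ w•a)·B) − Σ_i w_i•log(A·exp(a_i)·B)‖ ≤ 2·(12000(θ+σ)³ + ⅓σ(θ+σ))·Σ_i w_i·‖A a_i A′‖` (conjugate the members past `A`, then
the context-free lemma with `Y = log(AB)`). [cite: Balaban1987RG1, (0.4)-(0.8) p.253] -/
theorem norm_mlog_conj_expMean_mul_sub_mean_le {ι : Type*} (s : Finset ι) {w : ι → ℝ} (hw0 : ∀ i ∈ s, 0 ≤ w i)
    (hw1 : ∑ i ∈ s, w i = 1) {a : ι → 𝔸} {A A' B Y : 𝔸} (hAA' : A * A' = 1) (hA'A : A' * A = 1) (hYexp : exp Y = A * B)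
    {θ σ : ℝ} (ha : ∀ i ∈ s, ‖A * a i * A'‖ ≤ θ) (hY : ‖Y‖ ≤ σ) (hθσ : θ + σ ≤ 3 / 20) :
    ‖mlog (A * exp (∑ i ∈ s, (w i : ℂ) • a i) * B) - ∑ i ∈ s, (w i : ℂ) • mlog (A * exp (a i) * B)‖
      ≤ 2 * (12000 * (θ + σ) ^ 3 + 1 / 3 * σ * (θ + σ)) * ∑ i ∈ s, w i * ‖A * a i * A'‖ := by
  -- move the members past `A`: `A e^{x} B = e^{A x A′} (A B)`
  have hconj : ∀ x : 𝔸, A * exp x * B = exp (A * x * A') * exp Y := by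
    intro x
    rw [exp_conj_eq_of_mul_eq_one hAA' hA'A, hYexp, mul_assoc (A * exp x) A' (A * B), ← mul_assoc A' A B, hA'A, one_mul]
  have hsum : A * (∑ i ∈ s, (w i : ℂ) • a i) * A' = ∑ i ∈ s, (w i : ℂ) • (A * a i * A') := by
    rw [Finset.mul_sum, Finset.sum_mul]
    exact Finset.sum_congr rfl fun i _ => by rw [mul_smul_comm, smul_mul_assoc]
  have h := norm_mlog_expMean_mul_sub_mean_le s hw0 hw1 (a := fun i => A * a i * A') (Y := Y) ha hY hθσ
  rw [← hsum, ← hconj] at h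
  have h2 : ∑ i ∈ s, (w i : ℂ) • mlog (exp (A * a i * A') * exp Y) = ∑ i ∈ s, (w i : ℂ) • mlog (A * exp (a i) * B) :=
    Finset.sum_congr rfl fun i _ => by rw [← hconj]
  rw [h2] at h
  exact h

end Banach

/-! ## §2 The `SU(N)` form -/

section SUN

variable {n : Type*} [Fintype n] [DecidableEq n] [Nonempty n]
variable {ι : Type*} [Fintype ι] [Nonempty ι]

/-- ★★ **MEMBER-MEAN IN AN `SU(N)` CONTEXT**: `W : ι → SU(N)` with `dist1 (W i) ≤ ρ < δ_N`, `ρ ≤ 1∕20`; context `A, B ∈ SU(N)` with `dist1 (A·B) ≤ ρ′ ≤ 1∕20`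
(only the PRODUCT of the context needs to be near `1` — e.g. the rest of a small plaquette word):
`‖log(A·ESU W·B) − |I|⁻¹Σ_i log(A·W_i·B)‖ ≤ 2·(12000(θ+σ)³ + ⅓σ(θ+σ))·|I|⁻¹Σ_i‖log W_i‖` with `θ = ρ∕(1−ρ)`, `σ = ρ′∕(1−ρ′)` — the hybrid step of
UV3-NODE §57.8 (C): one averaged edge of the plaquette word replaced by its members at the cost of (small) × (mean member size). [cite: Balaban1987RG1, (0.4)-(0.8) p.253] -/
theorem norm_mlog_ctx_ESU_mul_sub_mean_le (W : ι → Matrix.specialUnitaryGroup n ℂ) (A B : Matrix.specialUnitaryGroup n ℂ)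
    {ρ ρ' : ℝ} (hρ : ρ < deltaSU n) (hρ20 : ρ ≤ 1 / 20) (hρ'20 : ρ' ≤ 1 / 20)
    (hW : ∀ i, dist1 (W i) ≤ ρ) (hAB : dist1 (A * B) ≤ ρ') :
    ‖mlog ((A : Matrix n n ℂ) * ((ESU W : Matrix.specialUnitaryGroup n ℂ) : Matrix n n ℂ) * (B : Matrix n n ℂ)) -
        ((Fintype.card ι : ℂ))⁻¹ • ∑ i, mlog ((A : Matrix n n ℂ) * (W i : Matrix n n ℂ) * (B : Matrix n n ℂ))‖
      ≤ 2 * (12000 * (ρ / (1 - ρ) + ρ' / (1 - ρ')) ^ 3 + 1 / 3 * (ρ' / (1 - ρ')) * (ρ / (1 - ρ) + ρ' / (1 - ρ'))) *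
          (((Fintype.card ι : ℝ))⁻¹ * ∑ i, ‖mlog (W i : Matrix n n ℂ)‖) := by
  have hρ0 : 0 ≤ ρ := (GaugeGroup.dist1_nonneg _).trans (hW (Classical.arbitrary ι))
  have hWn : ∀ i, ‖(W i : Matrix n n ℂ) - 1‖ ≤ ρ := fun i => hW i
  have hABn : ‖((A * B : Matrix.specialUnitaryGroup n ℂ) : Matrix n n ℂ) - 1‖ ≤ ρ' := hAB
  set a : ι → Matrix n n ℂ := fun i => mlog (W i : Matrix n n ℂ) with ha
  set Y : Matrix n n ℂ := mlog ((A * B : Matrix.specialUnitaryGroup n ℂ) : Matrix n n ℂ) with hY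
  have hθ : ∀ i, ‖a i‖ ≤ ρ / (1 - ρ) := fun i => by
    have h1 : ‖(W i : Matrix n n ℂ) - 1‖ < 1 := (hWn i).trans_lt (by linarith)
    refine (norm_mlog_le_div h1).trans ?_
    rw [div_le_div_iff₀ (by linarith) (by linarith)]; nlinarith [hWn i, norm_nonneg ((W i : Matrix n n ℂ) - 1)]
  have hσ : ‖Y‖ ≤ ρ' / (1 - ρ') := by
    have h1 : ‖((A * B : Matrix.specialUnitaryGroup n ℂ) : Matrix n n ℂ) - 1‖ < 1 := hABn.trans_lt (by linarith)
    refine (norm_mlog_le_div h1).trans ?_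
    rw [div_le_div_iff₀ (by linarith) (by linarith)]; nlinarith [hABn, norm_nonneg (((A * B : Matrix.specialUnitaryGroup n ℂ) : Matrix n n ℂ) - 1)]
  have hθσ : ρ / (1 - ρ) + ρ' / (1 - ρ') ≤ 3 / 20 := by
    have h1 : ρ / (1 - ρ) ≤ 1 / 19 := by rw [div_le_div_iff₀ (by linarith) (by norm_num)]; linarith
    have hρ'0 : 0 ≤ ρ' := (GaugeGroup.dist1_nonneg _).trans hAB
    have h2 : ρ' / (1 - ρ') ≤ 1 / 19 := by rw [div_le_div_iff₀ (by linarith) (by norm_num)]; linarith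
    linarith
  -- inverses and exponentials
  have hAA' : (A : Matrix n n ℂ) * ((A⁻¹ : Matrix.specialUnitaryGroup n ℂ) : Matrix n n ℂ) = 1 := by
    rw [← Submonoid.coe_mul, mul_inv_cancel, OneMemClass.coe_one]
  have hA'A : ((A⁻¹ : Matrix.specialUnitaryGroup n ℂ) : Matrix n n ℂ) * (A : Matrix n n ℂ) = 1 := by
    rw [← Submonoid.coe_mul, inv_mul_cancel, OneMemClass.coe_one]
  have hYexp : exp Y = (A : Matrix n n ℂ) * (B : Matrix n n ℂ) := by
    rw [hY, exp_mlog (hABn.trans_lt (by linarith)), Submonoid.coe_mul]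
  have hexpW : ∀ i, exp (a i) = (W i : Matrix n n ℂ) := fun i => exp_mlog ((hWn i).trans_lt (by linarith))
  have hguard : ∀ i, ‖(W i : Matrix n n ℂ) - 1‖ < deltaSU n := fun i => (hWn i).trans_lt hρ
  have hESU : ((ESU W : Matrix.specialUnitaryGroup n ℂ) : Matrix n n ℂ) = exp (((Fintype.card ι : ℂ))⁻¹ • ∑ i, a i) := by
    rw [coe_ESU_of_small hguard, eml_eq_exp]
  -- conjugation by `A` is an isometry of the operator norm (lit ✓`SolovayKitaev.norm_conj`-class fact; re-derived inline)
  have norm_conj_eq : ∀ X : Matrix n n ℂ, ‖(A : Matrix n n ℂ) * X * ((A⁻¹ : Matrix.specialUnitaryGroup n ℂ) : Matrix n n ℂ)‖ = ‖X‖ := fun X => by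
    rw [CStarRing.norm_mul_mem_unitary _ (Matrix.specialUnitaryGroup_le_unitaryGroup (A⁻¹).2),
      CStarRing.norm_mem_unitary_mul _ (Matrix.specialUnitaryGroup_le_unitaryGroup A.2)]
  -- conjugated sizes equal the plain sizes
  have hθ' : ∀ i ∈ (Finset.univ : Finset ι), ‖(A : Matrix n n ℂ) * a i * ((A⁻¹ : Matrix.specialUnitaryGroup n ℂ) : Matrix n n ℂ)‖ ≤ ρ / (1 - ρ) :=
    fun i _ => by rw [norm_conj_eq]; exact hθ i
  have hc : (0 : ℝ) < Fintype.card ι := Nat.cast_pos.mpr Fintype.card_pos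
  have hmain := norm_mlog_conj_expMean_mul_sub_mean_le (𝔸 := Matrix n n ℂ) Finset.univ (w := fun _ : ι => ((Fintype.card ι : ℝ))⁻¹)
    (fun _ _ => inv_nonneg.mpr hc.le) (by rw [Finset.sum_const, Finset.card_univ, nsmul_eq_mul, mul_inv_cancel₀ hc.ne'])
    (a := a) hAA' hA'A hYexp hθ' hσ hθσ
  have hcoe : ((((Fintype.card ι : ℝ))⁻¹ : ℝ) : ℂ) = ((Fintype.card ι : ℂ))⁻¹ := by
    rw [Complex.ofReal_inv, Complex.ofReal_natCast]
  simp only [hcoe, norm_conj_eq] at hmain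
  rw [← Finset.smul_sum, ← Finset.smul_sum, ← Finset.mul_sum] at hmain
  simp only [hexpW] at hmain
  rw [hESU]
  exact hmain

end SUN

end Summit.QuantumFields.YangMills.Theorems.FluctuationComparisonRegPrIntLS2BetaEmlMemberTransportMeanContext

end
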